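import Summits.ValiantsHypothesis.ValiantsHypothesis.Theorems.BarrierLeverPartitionMinorsChowProductStateTables

/-!
# Route BarrierLever — Chow witnesses for partition minors (item 20172, CPM): the SYMMETRIC-FORMS
# design (`ChowHitsSymmetricForms` / CatCPM) hits every PRINCIPAL-TYPE layout, at every height and
# every size — an all-`h` theorem for an infinite sub-class of the symmetric design

Helper file (`--supports stmt-ValiantsHypothesis-20172`; cell valiant-natproofs, rung V4, 𝒟-side of
door (c); seat valiant-natproofs-prover gen 12; director-valiant g7's round-close ruling on row 8,
2026-08-27T13:24Z: the conjecture `ChowHitsSymmetricForms` is re-asked as an item only if «probes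
h ≤ 10 clean AND an all-h theorem for an infinite sub-class has landed» — this file is the second).
Closes NO item; definition-free.

Conventions (items 19717 / 20172 / 20195; `…ChowSymmetricForms`): `x_a = X (Fin.castAdd h a)`,
`y_c = X (Fin.natAdd h c)`, `E u w = Σ_{a∈u} e_{x_a} + Σ_{c∈w} e_{y_c}`.  The SYMMETRIC-FORMS design of
planner valiant-natproofs-p1 g15 (text `ChowHitsSymmetricForms`, HOME/p1/g15/Sketch.lean; door
`ChowFactor.chowHitsPartitionMinors_of_symmetricForms`): `h + h` affine forms
`1 + Σ_a β k a · (x_a + y_a)`, i.e. `f(x, y) = g(x + y)` for ONE product `g` of `2h` affine forms in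
`h` variables.

* `symmetricForms_hit_principal` — **for every `h`, every `r ≤ 2^h`, every injective row family `u`
  and every rearrangement `w = u ∘ κ` of it, SOME choice of the symmetric design has a nonzero
  partition minor on `(u, w)`** — the conclusion of `ChowHitsSymmetricForms` for all principal-type
  layouts.  Witness: `β (castAdd a) = e_a`, `β (natAdd a) = −e_a`, i.e.
  `g(z) = ∏_a (1 + z_a)(1 − z_a) = ∏_a (1 − z_a²)`, `f = ∏_a (1 − (x_a + y_a)²)`, whose partition
  matrix is DIAGONAL: `coeff_{x^u y^w} f = [u = w] · (−2)^{|u|}` (per site the multilinear table of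
  `(1 + x + y)(1 − x − y)` is `diag(1, −2)`; `coeff_partitionExpo_prod_pairedSites` of
  `…ChowProductStateTables` with the identity pairing).

So the symmetric design reaches the principal-type class by the same diagonal mechanism as
val-np-p3's product state `∏_a (1 + x_a y_a)` (`partitionMinor_hit_of_principal`, item 19717), inside
the much smaller family `f = g(x + y)`.

WHAT THIS IS NOT: the symmetric-forms conjecture itself (all layouts) is OPEN — numerically clean
through `h = 4` exhaustively and all structured probes `h ≤ 10` (planner kit j272863, j277694,
j279853); translates `w = u ∆ s` with `s ≠ ∅` are NOT covered here (the constant-`1` normalisation of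
the text forbids the anti-diagonal site `(x_a + y_a) · 1`); nothing on items 20172 / 20195 / 19717
themselves, on crux stmt-ValiantsHypothesis-14610, or on `VP` versus `VNP`.
-/

set_option linter.dupNamespace false

namespace Summit.ValiantsHypothesis.ValiantsHypothesis.Theorems.BarrierLever.ChowFactor

open Finset MvPolynomial

noncomputable section

variable {h : ℕ}

/-- The diagonal table test, with a pairing `π`:
`∏_a [ [a∈u] = [π a∈w] ] · (−2)^{[a∈u]} = [∀ a, a ∈ u ↔ π a ∈ w] · (−2)^{#u}`. -/
theorem prod_diagTable_eq (π : Equiv.Perm (Fin h)) (u w : Finset (Fin h)) :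
    (∏ a : Fin h, (if decide (a ∈ u) = decide (π a ∈ w) then
        (if decide (a ∈ u) = true then (-2 : ℂ) else 1) else 0)) =
      if (∀ a, a ∈ u ↔ π a ∈ w) then (-2 : ℂ) ^ u.card else 0 := by
  classical
  by_cases hall : ∀ a, a ∈ u ↔ π a ∈ w
  · rw [if_pos hall]
    have hprod : (∏ a : Fin h, (if decide (a ∈ u) = decide (π a ∈ w) then
        (if decide (a ∈ u) = true then (-2 : ℂ) else 1) else 0)) = ∏ a : Fin h, (if a ∈ u then (-2 : ℂ) else 1) := by
      refine Finset.prod_congr rfl fun a _ => ?_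
      by_cases ha : a ∈ u
      · have hb : π a ∈ w := (hall a).mp ha
        simp [ha, hb]
      · have hb : π a ∉ w := fun hb => ha ((hall a).mpr hb)
        simp [ha, hb]
    rw [hprod, Finset.prod_ite_mem, Finset.univ_inter, Finset.prod_const]
  · rw [if_neg hall]
    push Not at hall
    obtain ⟨a, ha⟩ := hall
    refine Finset.prod_eq_zero (Finset.mem_univ a) ?_
    rw [if_neg]
    by_cases hu : a ∈ u <;> by_cases hw : π a ∈ w <;> simp [hu, hw] at ha ⊢

/-- The symmetric forms of the diagonal witness: `β (castAdd a) = e_a`, `β (natAdd a) = −e_a`;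
their product is `∏_a (1 + (x_a + y_a)) (1 − (x_a + y_a))` written as paired affine sites. -/
theorem prod_symmetricDiagForms_eq :
    (∏ k : Fin (h + h), (1 + ∑ a, C ((Fin.addCases (motive := fun _ => Fin h → ℂ)
        (fun a₀ a => if a = a₀ then (1 : ℂ) else 0) (fun a₀ a => if a = a₀ then (-1 : ℂ) else 0) k) a) *
          (X (Fin.castAdd h a) + X (Fin.natAdd h a)) : MvPolynomial (Fin (h + h)) ℂ)) =
      ∏ a : Fin h, ((C 1 + C 1 * X (Fin.castAdd h a) + C 1 * X (Fin.natAdd h ((Equiv.refl _) a))) *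
        (C 1 + C (-1) * X (Fin.castAdd h a) + C (-1) * X (Fin.natAdd h ((Equiv.refl _) a)))) := by
  classical
  rw [Fin.prod_univ_add, ← Finset.prod_mul_distrib]
  refine Finset.prod_congr rfl fun a _ => ?_
  simp only [Fin.addCases_left, Fin.addCases_right, Equiv.refl_apply]
  have hsum : ∀ c : ℂ, (∑ a' : Fin h, C (if a' = a then c else 0) *
      (X (Fin.castAdd h a') + X (Fin.natAdd h a')) : MvPolynomial (Fin (h + h)) ℂ) =
      C c * (X (Fin.castAdd h a) + X (Fin.natAdd h a)) := by
    intro c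
    rw [Finset.sum_eq_single a]
    · rw [if_pos rfl]
    · intro a' _ ha'; rw [if_neg ha', C_0, zero_mul]
    · intro ha; exact absurd (Finset.mem_univ a) ha
  rw [hsum, hsum, C_1, map_neg, C_1]
  ring

/-- **THE SYMMETRIC-FORMS DESIGN HITS EVERY PRINCIPAL-TYPE LAYOUT (every `h`, every `r`).**  For an
injective row family `u` and columns `w = u ∘ κ`, the symmetric forms `1 ± (x_a + y_a)` (`β = ±e_a`) give
the partition minor `det[[u i = u (κ j)] (−2)^{#(u i)}] = ±∏_i (−2)^{#(u i)} ≠ 0` — the conclusion of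
`ChowHitsSymmetricForms` (planner valiant-natproofs-p1 g15) on this infinite class. -/
theorem symmetricForms_hit_principal {r : ℕ} (u w : Fin r → Finset (Fin h)) (hu : Function.Injective u)
    (κ : Equiv.Perm (Fin r)) (hκ : ∀ j, w j = u (κ j)) :
    ∃ β : Fin (h + h) → Fin h → ℂ,
      (Matrix.of fun i j : Fin r => MvPolynomial.coeff
        (∑ a ∈ u i, Finsupp.single (Fin.castAdd h a) 1 + ∑ c ∈ w j, Finsupp.single (Fin.natAdd h c) 1)
        (∏ k, (1 + ∑ a, C (β k a) * (X (Fin.castAdd h a) + X (Fin.natAdd h a)) :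
          MvPolynomial (Fin (h + h)) ℂ))).det ≠ 0 := by
  classical
  refine ⟨Fin.addCases (motive := fun _ => Fin h → ℂ)
    (fun a₀ a => if a = a₀ then (1 : ℂ) else 0) (fun a₀ a => if a = a₀ then (-1 : ℂ) else 0), ?_⟩
  have hM : (Matrix.of fun i j : Fin r => MvPolynomial.coeff
        (∑ a ∈ u i, Finsupp.single (Fin.castAdd h a) 1 + ∑ c ∈ w j, Finsupp.single (Fin.natAdd h c) 1)
        (∏ k : Fin (h + h), (1 + ∑ a, C ((Fin.addCases (motive := fun _ => Fin h → ℂ)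
          (fun a₀ a => if a = a₀ then (1 : ℂ) else 0) (fun a₀ a => if a = a₀ then (-1 : ℂ) else 0) k) a) *
            (X (Fin.castAdd h a) + X (Fin.natAdd h a)) : MvPolynomial (Fin (h + h)) ℂ))) =
      (Matrix.diagonal fun i : Fin r => (-2 : ℂ) ^ (u i).card).submatrix id κ := by
    ext i j
    rw [Matrix.of_apply, prod_symmetricDiagForms_eq,
      coeff_partitionExpo_prod_pairedSites (Equiv.refl _) (fun _ => 1) (fun _ => 1) (fun _ => 1)
        (fun _ => 1) (fun _ => -1) (fun _ => -1)
        (fun a ε η => if ε = η then (if ε = true then (-2 : ℂ) else 1) else 0)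
        (fun a => by norm_num) (fun a => by norm_num) (fun a => by norm_num) (fun a => by norm_num),
      Matrix.submatrix_apply, Matrix.diagonal_apply, id, hκ j]
    rw [prod_diagTable_eq (Equiv.refl (Fin h)) (u i) (u (κ j))]
    have hiff : (∀ a, a ∈ u i ↔ (Equiv.refl (Fin h)) a ∈ u (κ j)) ↔ i = κ j := by
      rw [← hu.eq_iff, Finset.ext_iff]
      exact Iff.rfl
    by_cases hij : i = κ j
    · rw [if_pos (hiff.mpr hij), if_pos hij, hij]
    · rw [if_neg (fun hh => hij (hiff.mp hh)), if_neg hij]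
  rw [hM, Matrix.det_permute', Matrix.det_diagonal]
  refine mul_ne_zero (Int.cast_ne_zero.mpr (Units.ne_zero _)) ?_
  exact Finset.prod_ne_zero_iff.mpr fun i _ => pow_ne_zero _ (by norm_num)

end

end Summit.ValiantsHypothesis.ValiantsHypothesis.Theorems.BarrierLever.ChowFactor
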